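import Mathlib
import Summits.Schanuel.Schanuel.Theorems.AclSubsetLogFreeCore.Negative.ExpAclField
import Summits.Schanuel.Schanuel.Theorems.AclSubsetLogFreeCore.Negative.BranchParity
import Literature.ModelTheory.ExponentialFields.DefinabilityParams

/-!
# Crux `AclSubsetLogFreeCore` — the COUNTABLE variant of (A) forces `C_EA` to be closed under all logarithms (so "finite" cannot be weakened to "countable")

Theorems for the crux (A) `RigidCore.AclSubsetLogFreeCore` (stmt-Schanuel-0968).  Under EAC the
registered lines prove that every countable `∅`-definable set lies in the countable core `ecl ∅`
(`stub_definableDichotomy` + CCP), and one might hope to replace `ecl ∅` by `C_EA` there.  This file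
records why not: the natural strengthening

  (A_ℵ₀)  every COUNTABLE `∅`-definable subset of `ℂ_exp` is contained in `C_EA`

implies `ln 2 ∈ C_EA` (`log_two_mem_logFreeCore_of_countableVariant`: the fibre `{z | e^z = 2}` is a
countable `∅`-definable set) and, more generally, that `C_EA` is closed under EVERY branch of the
logarithm of each of its non-zero elements (`log_mem_logFreeCore_of_countableVariant`, via the
tightness `C_EA ⊆ acl(∅)`: `a ∈ C_EA` lies in a finite `∅`-definable `t`, and `exp⁻¹(t)` is countable
and `∅`-definable), i.e. `C_EA` would be an ELA-subfield containing `ln 2, ln 3, ln π, ln ln 2, …`.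
Under Schanuel's conjecture this is false (`C_EA = K_ω` is the free EA-closure of `ℚ(2πi)`, which is
not L-closed: `ln 2 ∉ K_ω`), so (A_ℵ₀) is refuted conditionally on SC and is NOT a route to (A):
any proof of (A) must use finiteness beyond countability — it must see why a FINITE parameter-free
definable set cannot contain a branch of `log 2` while the countable set of all branches is definable.
(Unconditionally (A_ℵ₀) is irrefutable for the usual reason: no explicit non-member of `C_EA` is known.)
-/

noncomputable section

set_option linter.dupNamespace false

open FirstOrder FirstOrder.Language Set
open Literature.ModelTheory.ExponentialFields

namespace Summit.Schanuel.Schanuel.Theorems.AclSubsetLogFreeCore.Negative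

/-- A fibre of `exp` is countable. -/
theorem countable_exp_fibre (c : ℂ) : {z : ℂ | Complex.exp z = c}.Countable := by
  by_cases hc : ∃ z₀, Complex.exp z₀ = c
  · obtain ⟨z₀, rfl⟩ := hc
    have hsub : {z : ℂ | Complex.exp z = Complex.exp z₀} ⊆
        Set.range (fun n : ℤ => z₀ + n * (2 * Real.pi * Complex.I)) := by
      intro z hz
      obtain ⟨n, hn⟩ := Complex.exp_eq_exp_iff_exists_int.1 hz
      exact ⟨n, hn.symm⟩
    exact (Set.countable_range _).mono hsub
  · have : {z : ℂ | Complex.exp z = c} = ∅ := by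
      ext z; simp only [Set.mem_setOf_eq, Set.mem_empty_iff_false, iff_false]
      exact fun h => hc ⟨z, h⟩
    rw [this]; exact Set.countable_empty

/-- The preimage under `exp` of a finite set is countable. -/
theorem countable_exp_preimage {t : Set ℂ} (ht : t.Finite) :
    {z : ℂ | Complex.exp z ∈ t}.Countable := by
  have : {z : ℂ | Complex.exp z ∈ t} = ⋃ c ∈ t, {z | Complex.exp z = c} := by
    ext z; simp
  rw [this]
  exact ht.countable.biUnion fun c _ => countable_exp_fibre c

/-- The preimage under `exp` of an `∅`-definable set is `∅`-definable. -/
theorem definable₁_exp_preimage {t : Set ℂ} (ht : Set.Definable₁ (∅ : Set ℂ) Language.expRing t) :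
    Set.Definable₁ (∅ : Set ℂ) Language.expRing {z : ℂ | Complex.exp z ∈ t} :=
  definable_mem_of_definable₁ ht (definableFun_cexp (definableFun_proj_params _))

/-- The set of ALL branches of `log 2` is a countable `∅`-definable set. -/
theorem definable₁_log_two_fibre :
    Set.Definable₁ (∅ : Set ℂ) Language.expRing {z : ℂ | Complex.exp z = 2} := by
  have h2 : (∅ : Set ℂ).DefinableFun Language.expRing (fun _ : Fin 1 → ℂ => (2 : ℂ)) := by
    simpa using definableFun_natCast' (A := (∅ : Set ℂ)) (α := Fin 1) 2
  exact definable_setOf_eq_params (definableFun_cexp (definableFun_proj_params _)) h2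

/-- **(A_ℵ₀) ⇒ `ln 2 ∈ C_EA`** (false under SC). -/
theorem log_two_mem_logFreeCore_of_countableVariant
    (h : ∀ s : Set ℂ, s.Countable → Set.Definable₁ (∅ : Set ℂ) Language.expRing s →
      s ⊆ (logFreeCore : Set ℂ)) :
    (Real.log 2 : ℂ) ∈ logFreeCore :=
  h _ (countable_exp_fibre 2) definable₁_log_two_fibre exp_log_two

/-- **(A_ℵ₀) ⇒ `C_EA` is closed under all logarithms of its elements** (an ELA-field; false under SC):
uses the tightness `C_EA ⊆ acl(∅)` (`logFreeCore_subset_expAcl`). -/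
theorem log_mem_logFreeCore_of_countableVariant
    (h : ∀ s : Set ℂ, s.Countable → Set.Definable₁ (∅ : Set ℂ) Language.expRing s →
      s ⊆ (logFreeCore : Set ℂ))
    {a : ℂ} (ha : a ∈ logFreeCore) {z : ℂ} (hz : Complex.exp z = a) : z ∈ logFreeCore := by
  obtain ⟨t, htfin, htdef, hat⟩ := logFreeCore_subset_expAcl ha
  exact h _ (countable_exp_preimage htfin) (definable₁_exp_preimage htdef) (by simp [hz, hat])

/-- In particular (A_ℵ₀) puts every branch of `log π` into `C_EA`: `ln π + 2πik ∈ C_EA`. -/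
theorem log_pi_mem_logFreeCore_of_countableVariant
    (h : ∀ s : Set ℂ, s.Countable → Set.Definable₁ (∅ : Set ℂ) Language.expRing s →
      s ⊆ (logFreeCore : Set ℂ)) (k : ℤ) :
    (Real.log Real.pi : ℂ) + k * (2 * Real.pi * Complex.I) ∈ logFreeCore := by
  -- `π ∈ C_EA` (`π = 2πi / 2i`, `i` algebraic)
  have hpi : (Real.pi : ℂ) ∈ logFreeCore := by
    have h2 : (2 * ↑Real.pi * Complex.I : ℂ) ∈ logFreeCore := two_pi_I_mem_logFreeCore
    have hI : Complex.I ∈ logFreeCore := by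
      refine logFreeCore_mem_coreFamily.2.2 _ ⟨Polynomial.X ^ 2 + 1, ?_, by simp⟩
      exact (Polynomial.monic_X_pow_add_C (1 : logFreeCore) two_ne_zero).ne_zero
    have h2' : (2 : ℂ) ∈ logFreeCore := by simp
    have : (Real.pi : ℂ) = (2 * ↑Real.pi * Complex.I) / (2 * Complex.I) := by field_simp
    rw [this]
    exact div_mem h2 (mul_mem h2' hI)
  refine log_mem_logFreeCore_of_countableVariant h hpi ?_
  rw [Complex.exp_add, Complex.exp_int_mul_two_pi_mul_I, mul_one, ← Complex.ofReal_exp,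
    Real.exp_log Real.pi_pos]

end Summit.Schanuel.Schanuel.Theorems.AclSubsetLogFreeCore.Negative
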